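/-
Copyright: the b2b-balaban T⁴-continuum CRUX team, row NE7b leaf lineage `t4-ne7b-formalise-leaf-03` (gen 146). Project licence.
-/
import Mathlib.Analysis.Calculus.FDeriv.Basic
import Mathlib.Analysis.Normed.Operator.ContinuousLinearMap
import Mathlib.Analysis.Calculus.LocalExtr.Basic
import Mathlib.Analysis.Calculus.Deriv.Add
import Mathlib.Analysis.Calculus.Deriv.Mul
import Mathlib.Analysis.Calculus.Deriv.Comp

/-!
# THE SECOND-ORDER ENVELOPE THEOREM FOR THE HARD LINEAR CONSTRAINT (Peano form): the value function
# `φ w = inf {V δ : D δ = w}` has at `w₀` the expansion `φ (w₀ + h) = φ w₀ + V′(N h) + q_D h + o(‖h‖²)`, whose quadratic term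
# `q_D h = inf {q v : D v = h}` is the CONSTRAINED SCHUR FORM of `V`'s own second-order form `q` at the constrained minimiser `δ₀`
# — «`D²φ` = the constrained Schur complement of `D²V`», the second-order half of T-80 (J1) for a LINEAR constraint (T-85 (L1)),
# the `a = ∞` twin of the step's modulus letter (row NE7b, node U5c; residual (R2′) family (2), letter (ℓ1); Mathlib only)

Cell `pub-balaban`, sub-cell `t4`, spine estimate NE7b (`T4WeightBudget.RelWeightBound`; the cell's OWN estimate — NOT PRINTED in
[Bałaban 1983–89], NOT PROVED).  Crux-route work under `Spine/NE7b/` by a row leaf on the convexity road; NOTHING of Bałaban's is named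
or asserted; no `T4Continuum/Support` leaf typed (FREEZE (0)); no `def`; zero `sorry`.  Imports: Mathlib only — independent of the
farm's `Spine/NE7b` olean frontier (so CVD's Fermat-on-the-fibre and bounded-below steps, §1 ∕ §6 there, are re-derived INLINE inside the
two §5 proofs rather than imported or restated; swap for the imports once CVD's olean exists).

WHY.  This lineage typed the constrained Schur form `Q_D w = inf {Q δ : D δ = w}` (`…ConstrainedSchurForm`, CSTF), the FIRST-order half
of the sensitivity of a linearly constrained minimum (`…ConstrainedValueDeriv`, CVD: `Dφ(w₀) = DV(δ₀) ∘ M`, the multiplier, chart-free;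
windowed `…ConstrainedValueWindow`; growth `…ConstrainedValueGrowth`), and left «the SECOND-ORDER sensitivity theorem (T-80 (J1) proper:
`D²φ` = the constrained Schur complement of `∇²V` …) NOT HERE».  Idea-1's T-85 (g85, `t4/ideate/NE7b/checks-g85/…`, §2 (E2) ∕ §4 (L1))
states the missing half for a LINEAR constraint — `D²φ(w₀)[h, h] = min {D²V(δ₀)[v, v] : D v = h}`, CSTF's multiplier form of the
Hessian — and prices it, as a `C²`-REGULARITY statement, as implicit-function territory (the `C¹` fibre-minimiser map).  THIS FILE types
it in PEANO currency, which needs NO implicit function and NO regularity of the minimiser map: if `V` has a second-order expansion at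
the constrained minimiser `δ₀` with quadratic term `q` (`V (δ₀ + v) = V δ₀ + V′ v + q v + o(‖v‖²)`) and obeys the road's STRONG
first-order letter at `δ₀` (modulus `(m∕2)‖·‖²` — it localises the fibres of nearby `w`), then `φ` has a second-order expansion at `w₀`
with linear term the multiplier `V′ ∘ N` and quadratic term `q ∘ N = q_D`, for any fibre-minimiser map `N` of `q` (CSTF §3's `M`:
`D M = 1`, `H M = D†Λ`; then `q_D h = ⟪h, Λ h⟫`).  The sequel `…ConstrainedValueHessian` (same lineage) adds: uniqueness of the
quadratic term (whatever Hessian `φ` has, it IS `q_D`), perturbed forms (T-85 (L3)), and the END in Hessian currency for a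
twice-differentiable `V` via the tree's Peano–Taylor lemma `Literature.Analysis.Convex.taylor_two_isLittleO_of_hasFDerivAt`.

WHAT IS PROVED ([folklore]; Fiacco, *Introduction to Sensitivity and Stability Analysis in Nonlinear Programming* (1983) §3.2 and
Bonnans–Shapiro, *Perturbation Analysis of Optimization Problems* (2000) §4.7 state the `C²` form; the Peano form below is the elementary
two-competitor argument):
* §1 FIBRE-MINIMISER MAPS of a form `q` (`D (N w) = w`, `q (N (D v)) ≤ q v`): `apply_fibreMin_le`, **`constrInf_eq_apply_fibreMin`**
  (`q_D h = q (N h)` — CSTF §3's `constrInf_quadForm_eq` in map currency, any types).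
* §2 **`secondOrder_constrValue_upper`** — THE UPPER LETTER THROUGH ANY RIGHT INVERSE: `V` bounded below, `δ₀` a constrained minimiser
  over `w₀`, the upper second-order letter of `V` at `δ₀` ⊢ `∀ ε > 0`, eventually in `h → 0`,
  `φ (w₀ + h) ≤ φ w₀ + V′ (N h) + q (N h) + ε‖h‖²` (competitor `δ₀ + N h`; no convexity, no `ker D` letter).
* §3 LOCALISATION `norm_sub_sq_le_of_firstOrder`: the strong first-order letter at `δ₀` and `V′ ⊥ ker D` ⊢ on the fibre of `w₀ + h`,
  `(m∕2)‖δ − δ₀‖² ≤ V δ − V δ₀ − V′ (N h)` (the linear term is constant on fibres — CVD §2); `isMinOn_fibre_of_firstOrder`.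
* §4 **`secondOrder_constrValue_lower`** — THE LOWER LETTER WITH THE CONSTRAINED SCHUR FORM: strong first-order letter (`m > 0`),
  `V′ ⊥ ker D`, `0 ≤ q ≤ c‖·‖²`, the lower second-order letter of `V` at `δ₀` ⊢ `∀ ε > 0`, eventually,
  `φ w₀ + V′ (N h) + q_D h ≤ φ (w₀ + h) + ε‖h‖²` (fibre points farther than `A‖h‖` from `δ₀` lose by the strong letter alone, nearer
  ones by the expansion; `A = 2c₊‖N‖²∕m + 1`).
* §5 THE END **`isLittleO_constrValue_secondOrder`** ∕ **`isLittleO_constrValue_secondOrder_of_isMinOn`**: with a fibre-minimiser map `N`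
  of `q` and the two-sided expansion `(v ↦ V (δ₀ + v) − V δ₀ − V′ v − q v) =o[𝓝 0] ‖v‖²`:
  `(h ↦ φ (w₀ + h) − φ w₀ − V′ (N h) − q (N h)) =o[𝓝 0] ‖h‖²` — the value function's second-order term is `q ∘ N = q_D` (the
  `_of_isMinOn` form takes the constrained-minimiser letter instead of `V′ ⊥ ker D`: Fermat on the fibre, from the derivative the
  expansion itself provides — `hasFDerivAt_of_isLittleO_secondOrder`).
* §6 a non-vacuity `example` (`D = N = id`: the END returns `V`'s own expansion).

NOT HERE (honest): `C²`-regularity of `φ` ∕ `C¹`-regularity of the fibre-minimiser map (implicit function; not needed for the Peano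
statement); NONLINEAR constraints (T-85 (L2): the chart `A = A′ − HD(A′)` and the Lagrangian form `D²V − λ∘D²G` — `…HessianChartTransport`
supplies the chart term, and the present file is then applied to `V ∘ Φ`); windowed (`K ∈ 𝓝 δ₀`) strong letters (`…ConstrainedValueWindow`'s
currency — §3 is already local in `h`; a window version is an append); which `V`, `D`, `q` of Bałaban's ((A3) ∕ (A1c), NC-NE7b-α
UNRULED); any value.  BY-NAME EFFECT ON THE WALL: NONE.  NE7b NOT PRINTED ∕ NOT PROVED; spine PROVED 0∕9; rung (B)+1 on a FINITE torus —
NOT infinite volume, NOT the mass gap, NOT Clay.  HONEST DEPENDENCY: continuum YM on T⁴ ⇐ BetaPertH ∧ nine spine estimates (0/9 proved);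
BetaPertH ⇐ (D1) ∧ (D4) ∧ CAP+tail; G-an2-4 gates asym, D1 and NE2∕3∕4.
-/

set_option autoImplicit false

open Set Function Filter Asymptotics Metric
open scoped Topology

namespace Summit.QuantumFields.BalabanUV.T4Continuum.NE7b.ConstrainedValueSecondOrder

/-! ## §1 Fibre-minimiser maps of a form: the constrained Schur form is attained along them -/

section FibreMin

variable {E F : Type*} {D : E → F} {q : E → ℝ} {N : F → E}

/-- A FIBRE-MINIMISER MAP `N` of the form `q` for the constraint `D` (`q (N (D v)) ≤ q v` for all `v`) realises the minimum of `q`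
on every fibre: `D v = h ⟹ q (N h) ≤ q v`.  (For `q = ⟪·, H ·⟫`, `H` symmetric `≥ 0`, CSTF §3's minimiser `M` — `D M = 1`,
`⟪H (M w), κ⟫ = 0` on `ker D` — is one, by `…ConstrainedSchurForm.min_le_quadForm`.) [folklore] -/
theorem apply_fibreMin_le (hNmin : ∀ v, q (N (D v)) ≤ q v) {h : F} {v : E} (hv : D v = h) : q (N h) ≤ q v := by
  have h1 := hNmin v
  rwa [hv] at h1

/-- **THE CONSTRAINED SCHUR FORM IS ATTAINED ALONG A FIBRE-MINIMISER MAP**: `D (N w) = w`, `q (N (D v)) ≤ q v` ⟹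
`q_D h = ⨅_{D v = h} q v = q (N h)` (no lower bound on `q` needed: `q (N h)` bounds the fibre below).  With CSTF §3's multiplier
letter `H M = D†Λ` this is the multiplier form `⟪h, Λ h⟫`. [folklore] -/
theorem constrInf_eq_apply_fibreMin (hN : ∀ w, D (N w) = w) (hNmin : ∀ v, q (N (D v)) ≤ q v) (h : F) :
    (⨅ v : {v // D v = h}, q v.1) = q (N h) := by
  haveI : Nonempty {v // D v = h} := ⟨⟨N h, hN h⟩⟩
  have hb : BddBelow (range fun v : {v // D v = h} => q v.1) :=
    ⟨q (N h), forall_mem_range.2 fun v => apply_fibreMin_le hNmin v.2⟩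
  exact le_antisymm (ciInf_le hb ⟨N h, hN h⟩) (le_ciInf fun v => apply_fibreMin_le hNmin v.2)

end FibreMin

/-! ## §2 The UPPER second-order letter of the value function, through any right inverse -/

section Normed

variable {E F : Type*} [NormedAddCommGroup E] [NormedSpace ℝ E] [NormedAddCommGroup F] [NormedSpace ℝ F]

/-- Pull an eventually-at-`0` statement on `E` back to `F` along a continuous linear map. [folklore] -/
theorem eventually_nhds_zero_comp_clm {P : E → Prop} (N : F →L[ℝ] E) (hP : ∀ᶠ v in 𝓝 (0 : E), P v) :
    ∀ᶠ h in 𝓝 (0 : F), P (N h) := by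
  have ht : Tendsto (fun h : F => N h) (𝓝 0) (𝓝 0) := by simpa using N.continuous.tendsto (0 : F)
  exact ht.eventually hP

/-- `‖N h‖² ≤ ‖N‖²‖h‖²`. [folklore] -/
theorem norm_clm_apply_sq_le (N : F →L[ℝ] E) (h : F) : ‖N h‖ ^ 2 ≤ ‖N‖ ^ 2 * ‖h‖ ^ 2 := by
  rw [← mul_pow]
  exact pow_le_pow_left₀ (norm_nonneg _) (N.le_opNorm h) 2

/-- **THE UPPER SECOND-ORDER LETTER OF THE VALUE FUNCTION, THROUGH ANY RIGHT INVERSE.**  `V` bounded below, `δ₀` a minimiser of `V`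
on the fibre `{D δ = w₀}`, `N` a continuous linear right inverse of `D`, and the UPPER second-order letter of `V` at `δ₀` with linear
term `V′` and quadratic term `q` (`∀ ε > 0`, eventually in `v → 0`, `V (δ₀ + v) ≤ V δ₀ + V′ v + q v + ε‖v‖²`) ⟹ `∀ ε > 0`,
eventually in `h → 0`: `φ (w₀ + h) ≤ φ w₀ + V′ (N h) + q (N h) + ε‖h‖²` (`φ w = ⨅_{D δ = w} V δ`).  Proof: the competitor
`δ₀ + N h` lies on the fibre of `w₀ + h`; `ε′ = ε ∕ (‖N‖² + 1)`.  No convexity and no `ker D` letter is used: the upper letter survives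
through EVERY right inverse (cf. `…ConstrainedSchurTower` §3). [folklore] -/
theorem secondOrder_constrValue_upper {V q : E → ℝ} {V' : E →L[ℝ] ℝ} {D : E →L[ℝ] F} {N : F →L[ℝ] E}
    (hN : ∀ w, D (N w) = w) (hbdd : ∃ m, ∀ δ, m ≤ V δ) {w₀ : F} {δ₀ : E} (hδ₀ : D δ₀ = w₀)
    (hmin : ∀ δ, D δ = w₀ → V δ₀ ≤ V δ)
    (hV2u : ∀ ε : ℝ, 0 < ε → ∀ᶠ v in 𝓝 (0 : E), V (δ₀ + v) ≤ V δ₀ + V' v + q v + ε * ‖v‖ ^ 2)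
    {ε : ℝ} (hε : 0 < ε) :
    ∀ᶠ h in 𝓝 (0 : F), (⨅ δ : {δ // D δ = w₀ + h}, V δ.1)
      ≤ (⨅ δ : {δ // D δ = w₀}, V δ.1) + V' (N h) + q (N h) + ε * ‖h‖ ^ 2 := by
  obtain ⟨m, hm⟩ := hbdd
  have hbddV : ∀ w, BddBelow (range fun δ : {δ // D δ = w} => V δ.1) :=
    fun w => ⟨m, forall_mem_range.2 fun δ => hm δ.1⟩
  have hφ0 : (⨅ δ : {δ // D δ = w₀}, V δ.1) = V δ₀ :=
    haveI : Nonempty {δ // D δ = w₀} := ⟨⟨δ₀, hδ₀⟩⟩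
    le_antisymm (ciInf_le (hbddV w₀) ⟨δ₀, hδ₀⟩) (le_ciInf fun δ => hmin δ.1 δ.2)
  have hε' : 0 < ε / (‖N‖ ^ 2 + 1) := div_pos hε (by positivity)
  filter_upwards [eventually_nhds_zero_comp_clm N (hV2u _ hε')] with h hh
  have h1 : (⨅ δ : {δ // D δ = w₀ + h}, V δ.1) ≤ V (δ₀ + N h) :=
    ciInf_le (hbddV _) ⟨δ₀ + N h, by rw [map_add, hδ₀, hN]⟩
  have h2 : ε / (‖N‖ ^ 2 + 1) * ‖N h‖ ^ 2 ≤ ε * ‖h‖ ^ 2 :=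
    calc ε / (‖N‖ ^ 2 + 1) * ‖N h‖ ^ 2 ≤ ε / (‖N‖ ^ 2 + 1) * (‖N‖ ^ 2 * ‖h‖ ^ 2) :=
          mul_le_mul_of_nonneg_left (norm_clm_apply_sq_le N h) hε'.le
      _ ≤ ε / (‖N‖ ^ 2 + 1) * ((‖N‖ ^ 2 + 1) * ‖h‖ ^ 2) := by gcongr; linarith
      _ = ε * ‖h‖ ^ 2 := by rw [← mul_assoc, div_mul_cancel₀ _ (by positivity)]
  rw [hφ0]
  linarith

/-! ## §3 Localisation of the fibres of nearby `w` by the strong first-order letter -/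

/-- The linear term is constant on fibres (CVD §2 in `w₀ + h` form): `V′ ⊥ ker D`, `D δ₀ = w₀`, `D δ = w₀ + h` ⟹
`V′ (δ − δ₀) = V′ (N h)`. [folklore] -/
theorem apply_sub_eq_apply_clm {V' : E →L[ℝ] ℝ} {D : E →L[ℝ] F} {N : F →L[ℝ] E} (hN : ∀ w, D (N w) = w)
    (hker : ∀ κ, D κ = 0 → V' κ = 0) {δ₀ δ : E} {w₀ h : F} (hδ₀ : D δ₀ = w₀) (hδ : D δ = w₀ + h) :
    V' (δ - δ₀) = V' (N h) := by
  have h0 := hker (δ - δ₀ - N h) (by rw [map_sub, map_sub, hδ, hδ₀, hN, add_sub_cancel_left, sub_self])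
  rwa [map_sub, sub_eq_zero] at h0

/-- **LOCALISATION.**  The STRONG first-order letter at `δ₀` (`V δ₀ + V′ (δ − δ₀) + (m∕2)‖δ − δ₀‖² ≤ V δ` for all `δ`) and
`V′ ⊥ ker D` ⟹ on the fibre of `w₀ + h`: `(m∕2)‖δ − δ₀‖² ≤ V δ − V δ₀ − V′ (N h)`.  So fibre points with `V δ ≤ V (δ₀ + N h)` are
`O(‖h‖)`-close to `δ₀` — the only compactness the second-order theorem needs. [folklore] -/
theorem norm_sub_sq_le_of_firstOrder {V : E → ℝ} {V' : E →L[ℝ] ℝ} {D : E →L[ℝ] F} {N : F →L[ℝ] E} (hN : ∀ w, D (N w) = w)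
    (hker : ∀ κ, D κ = 0 → V' κ = 0) {m : ℝ} {δ₀ : E} (hfo : ∀ δ, V δ₀ + V' (δ - δ₀) + m / 2 * ‖δ - δ₀‖ ^ 2 ≤ V δ)
    {w₀ h : F} (hδ₀ : D δ₀ = w₀) {δ : E} (hδ : D δ = w₀ + h) : m / 2 * ‖δ - δ₀‖ ^ 2 ≤ V δ - V δ₀ - V' (N h) := by
  have h1 := hfo δ
  rw [apply_sub_eq_apply_clm hN hker hδ₀ hδ] at h1
  linarith

/-- On its own fibre `δ₀` is the minimiser (strong letter + `V′ ⊥ ker D`). [folklore] -/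
theorem isMinOn_fibre_of_firstOrder {V : E → ℝ} {V' : E →L[ℝ] ℝ} {D : E →L[ℝ] F} (hker : ∀ κ, D κ = 0 → V' κ = 0)
    {m : ℝ} (hm : 0 ≤ m) {δ₀ : E} (hfo : ∀ δ, V δ₀ + V' (δ - δ₀) + m / 2 * ‖δ - δ₀‖ ^ 2 ≤ V δ) {w₀ : F} (hδ₀ : D δ₀ = w₀) :
    ∀ δ, D δ = w₀ → V δ₀ ≤ V δ := by
  intro δ hδ
  have h1 := hfo δ
  rw [hker (δ - δ₀) (by rw [map_sub, hδ, hδ₀, sub_self])] at h1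
  nlinarith [sq_nonneg ‖δ - δ₀‖]

/-! ## §4 The LOWER second-order letter of the value function, with the constrained Schur form -/

/-- **THE LOWER SECOND-ORDER LETTER OF THE VALUE FUNCTION.**  `N` a continuous linear right inverse of `D`, `D δ₀ = w₀`,
`V′ ⊥ ker D` (Fermat on the fibre), the STRONG first-order letter at `δ₀` with `m > 0`, a form `0 ≤ q ≤ c‖·‖²`, and the LOWER
second-order letter of `V` at `δ₀` (`∀ ε > 0`, eventually in `v → 0`, `V δ₀ + V′ v + q v ≤ V (δ₀ + v) + ε‖v‖²`) ⟹ `∀ ε > 0`, eventually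
in `h → 0`: `φ w₀ + V′ (N h) + q_D h ≤ φ (w₀ + h) + ε‖h‖²`, `q_D h = ⨅_{D v = h} q v`.  Proof: with `A = 2cp‖N‖²∕m + 1`, a fibre point
`δ` of `w₀ + h` with `‖δ − δ₀‖ > A‖h‖` satisfies `V δ ≥ V δ₀ + V′ (N h) + cp‖N‖²‖h‖² ≥ … + q (N h) ≥ … + q_D h` by §3 alone; one with
`‖δ − δ₀‖ ≤ A‖h‖` is in the expansion's neighbourhood once `‖h‖ < r∕A`, and `q (δ − δ₀) ≥ q_D h`. [folklore] -/
theorem secondOrder_constrValue_lower {V q : E → ℝ} {V' : E →L[ℝ] ℝ} {D : E →L[ℝ] F} {N : F →L[ℝ] E}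
    (hN : ∀ w, D (N w) = w) {w₀ : F} {δ₀ : E} (hδ₀ : D δ₀ = w₀) (hker : ∀ κ, D κ = 0 → V' κ = 0)
    {m : ℝ} (hm : 0 < m) (hfo : ∀ δ, V δ₀ + V' (δ - δ₀) + m / 2 * ‖δ - δ₀‖ ^ 2 ≤ V δ)
    (hq0 : ∀ v, 0 ≤ q v) {c : ℝ} (hqc : ∀ v, q v ≤ c * ‖v‖ ^ 2)
    (hV2l : ∀ ε : ℝ, 0 < ε → ∀ᶠ v in 𝓝 (0 : E), V δ₀ + V' v + q v ≤ V (δ₀ + v) + ε * ‖v‖ ^ 2)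
    {ε : ℝ} (hε : 0 < ε) :
    ∀ᶠ h in 𝓝 (0 : F), (⨅ δ : {δ // D δ = w₀}, V δ.1) + V' (N h) + (⨅ v : {v // D v = h}, q v.1)
      ≤ (⨅ δ : {δ // D δ = w₀ + h}, V δ.1) + ε * ‖h‖ ^ 2 := by
  set cp : ℝ := max c 0 with hcp
  have hcp0 : 0 ≤ cp := le_max_right _ _
  have hqcp : ∀ v, q v ≤ cp * ‖v‖ ^ 2 := fun v => (hqc v).trans (by gcongr; exact le_max_left _ _)
  set A : ℝ := 2 * cp * ‖N‖ ^ 2 / m + 1 with hA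
  have hA1 : 1 ≤ A := by
    have : 0 ≤ 2 * cp * ‖N‖ ^ 2 / m := by positivity
    linarith
  have hApos : 0 < A := by linarith
  have hε' : 0 < ε / A ^ 2 := by positivity
  obtain ⟨r, hr, hball⟩ := Metric.eventually_nhds_iff.1 (hV2l _ hε')
  have hbdd0 : BddBelow (range fun δ : {δ // D δ = w₀} => V δ.1) :=
    ⟨V δ₀, forall_mem_range.2 fun δ => isMinOn_fibre_of_firstOrder hker hm.le hfo hδ₀ δ.1 δ.2⟩
  have hφ0 : (⨅ δ : {δ // D δ = w₀}, V δ.1) ≤ V δ₀ := ciInf_le hbdd0 ⟨δ₀, hδ₀⟩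
  refine Metric.eventually_nhds_iff.2 ⟨r / A, div_pos hr hApos, fun h hh => ?_⟩
  rw [dist_zero_right] at hh
  haveI : Nonempty {δ // D δ = w₀ + h} := ⟨⟨δ₀ + N h, by rw [map_add, hδ₀, hN]⟩⟩
  have hbddq : BddBelow (range fun v : {v // D v = h} => q v.1) := ⟨0, forall_mem_range.2 fun v => hq0 v.1⟩
  have hqD_le : (⨅ v : {v // D v = h}, q v.1) ≤ q (N h) := ciInf_le hbddq ⟨N h, hN h⟩
  have hqN : q (N h) ≤ cp * ‖N‖ ^ 2 * ‖h‖ ^ 2 :=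
    (hqcp (N h)).trans (by rw [mul_assoc]; exact mul_le_mul_of_nonneg_left (norm_clm_apply_sq_le N h) hcp0)
  have key : ∀ δ : {δ // D δ = w₀ + h},
      V δ₀ + V' (N h) + (⨅ v : {v // D v = h}, q v.1) - ε * ‖h‖ ^ 2 ≤ V δ.1 := by
    rintro ⟨δ, hδ⟩
    have hv : D (δ - δ₀) = h := by rw [map_sub, hδ, hδ₀, add_sub_cancel_left]
    have hlin : V' (δ - δ₀) = V' (N h) := apply_sub_eq_apply_clm hN hker hδ₀ hδ
    have hstrong : m / 2 * ‖δ - δ₀‖ ^ 2 ≤ V δ - V δ₀ - V' (N h) := norm_sub_sq_le_of_firstOrder hN hker hfo hδ₀ hδ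
    have hεh : 0 ≤ ε * ‖h‖ ^ 2 := by positivity
    by_cases hcase : A * ‖h‖ < ‖δ - δ₀‖
    · -- far from `δ₀`: the strong letter alone
      have h1 : A * ‖h‖ ^ 2 ≤ ‖δ - δ₀‖ ^ 2 := by
        have h1a : (A * ‖h‖) ^ 2 ≤ ‖δ - δ₀‖ ^ 2 := pow_le_pow_left₀ (by positivity) hcase.le 2
        have h1b : A * ‖h‖ ^ 2 ≤ (A * ‖h‖) ^ 2 := by
          rw [mul_pow]
          exact mul_le_mul_of_nonneg_right (by nlinarith) (sq_nonneg _)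
        exact h1b.trans h1a
      have h2 : m / 2 * (A * ‖h‖ ^ 2) = (cp * ‖N‖ ^ 2 + m / 2) * ‖h‖ ^ 2 := by
        rw [hA]
        field_simp
      have h3 : cp * ‖N‖ ^ 2 * ‖h‖ ^ 2 ≤ m / 2 * ‖δ - δ₀‖ ^ 2 := by
        have h3a : m / 2 * (A * ‖h‖ ^ 2) ≤ m / 2 * ‖δ - δ₀‖ ^ 2 := mul_le_mul_of_nonneg_left h1 (by positivity)
        have h3b : 0 ≤ m / 2 * ‖h‖ ^ 2 := by positivity
        linarith
      simp only
      linarith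
    · -- near `δ₀`: the lower expansion
      rw [not_lt] at hcase
      have hsmall : dist (δ - δ₀) 0 < r := by
        rw [dist_zero_right]
        calc ‖δ - δ₀‖ ≤ A * ‖h‖ := hcase
          _ < A * (r / A) := by gcongr
          _ = r := mul_div_cancel₀ _ hApos.ne'
      have hexp := hball hsmall
      rw [add_sub_cancel, hlin] at hexp
      have hqv : (⨅ v : {v // D v = h}, q v.1) ≤ q (δ - δ₀) := ciInf_le hbddq ⟨δ - δ₀, hv⟩
      have hε'le : ε / A ^ 2 * ‖δ - δ₀‖ ^ 2 ≤ ε * ‖h‖ ^ 2 := by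
        have h4 : ‖δ - δ₀‖ ^ 2 ≤ A ^ 2 * ‖h‖ ^ 2 := by
          rw [← mul_pow]
          exact pow_le_pow_left₀ (norm_nonneg _) hcase 2
        calc ε / A ^ 2 * ‖δ - δ₀‖ ^ 2 ≤ ε / A ^ 2 * (A ^ 2 * ‖h‖ ^ 2) := mul_le_mul_of_nonneg_left h4 hε'.le
          _ = ε * ‖h‖ ^ 2 := by rw [← mul_assoc, div_mul_cancel₀ _ (by positivity)]
      simp only
      linarith
  linarith [le_ciInf key]

/-! ## §5 THE END: the second-order expansion of the value function — quadratic term `q ∘ N = q_D` -/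

/-- The two one-sided letters from the two-sided expansion `(v ↦ V (δ₀ + v) − V δ₀ − V′ v − q v) =o[𝓝 0] ‖v‖²`. [folklore] -/
theorem eventually_abs_le_of_isLittleO_secondOrder {V q : E → ℝ} {V' : E →L[ℝ] ℝ} {δ₀ : E}
    (hV2 : (fun v => V (δ₀ + v) - V δ₀ - V' v - q v) =o[𝓝 (0 : E)] fun v => ‖v‖ ^ 2) {ε : ℝ} (hε : 0 < ε) :
    ∀ᶠ v in 𝓝 (0 : E), V (δ₀ + v) ≤ V δ₀ + V' v + q v + ε * ‖v‖ ^ 2 ∧ V δ₀ + V' v + q v ≤ V (δ₀ + v) + ε * ‖v‖ ^ 2 := by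
  filter_upwards [hV2.def hε] with v hv
  rw [Real.norm_eq_abs, Real.norm_of_nonneg (by positivity), abs_le] at hv
  constructor <;> linarith [hv.1, hv.2]

/-- **THE SECOND-ORDER ENVELOPE THEOREM FOR THE HARD LINEAR CONSTRAINT (Peano form).**  `N : F →L[ℝ] E` a right inverse of
`D : E →L[ℝ] F` which is ALSO a fibre-minimiser map of the form `q` (`q (N (D v)) ≤ q v`; CSTF §3's `M` for `q = ⟪·, H ·⟫`),
`D δ₀ = w₀`, `V′ ⊥ ker D`, the strong first-order letter of `V` at `δ₀` (`m > 0`), `0 ≤ q ≤ c‖·‖²`, and the second-order expansion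
`(v ↦ V (δ₀ + v) − V δ₀ − V′ v − q v) =o[𝓝 0] ‖v‖²` ⟹
`(h ↦ φ (w₀ + h) − φ w₀ − V′ (N h) − q (N h)) =o[𝓝 0] ‖h‖²`, `φ w = ⨅_{D δ = w} V δ`:
the value function has a second-order expansion at `w₀` whose linear term is the multiplier `V′ ∘ N` (CVD §4) and whose QUADRATIC
TERM IS `q ∘ N = q_D`, the constrained Schur form of `V`'s second-order form (§1) — «`D²φ(w₀)` = the constrained Schur complement of
`D²V(δ₀)`», T-85 (L1) ∕ the second-order half of T-80 (J1), with no implicit function. [folklore] -/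
theorem isLittleO_constrValue_secondOrder {V q : E → ℝ} {V' : E →L[ℝ] ℝ} {D : E →L[ℝ] F} {N : F →L[ℝ] E}
    (hN : ∀ w, D (N w) = w) (hNmin : ∀ v, q (N (D v)) ≤ q v) {w₀ : F} {δ₀ : E} (hδ₀ : D δ₀ = w₀)
    (hker : ∀ κ, D κ = 0 → V' κ = 0) {m : ℝ} (hm : 0 < m) (hfo : ∀ δ, V δ₀ + V' (δ - δ₀) + m / 2 * ‖δ - δ₀‖ ^ 2 ≤ V δ)
    (hq0 : ∀ v, 0 ≤ q v) {c : ℝ} (hqc : ∀ v, q v ≤ c * ‖v‖ ^ 2)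
    (hV2 : (fun v => V (δ₀ + v) - V δ₀ - V' v - q v) =o[𝓝 (0 : E)] fun v => ‖v‖ ^ 2) :
    (fun h => (⨅ δ : {δ // D δ = w₀ + h}, V δ.1) - (⨅ δ : {δ // D δ = w₀}, V δ.1) - V' (N h) - q (N h))
      =o[𝓝 (0 : F)] fun h => ‖h‖ ^ 2 := by
  have hbdd : ∃ c, ∀ δ, c ≤ V δ := by
    -- `V ≥ V δ₀ − ‖V′‖²∕(2m)` from the strong letter (as `…ConstrainedValueDeriv` §6; no olean to import yet)
    refine ⟨V δ₀ - ‖V'‖ ^ 2 / (2 * m), fun δ => ?_⟩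
    have h1 : -(‖V'‖ * ‖δ - δ₀‖) ≤ V' (δ - δ₀) := by
      have h := V'.le_opNorm (δ - δ₀)
      rw [Real.norm_eq_abs] at h
      linarith [neg_abs_le (V' (δ - δ₀))]
    have h2 : 0 ≤ ‖V'‖ ^ 2 / (2 * m) + m / 2 * ‖δ - δ₀‖ ^ 2 - ‖V'‖ * ‖δ - δ₀‖ := by
      have h3 : ‖V'‖ ^ 2 / (2 * m) + m / 2 * ‖δ - δ₀‖ ^ 2 - ‖V'‖ * ‖δ - δ₀‖
          = (‖V'‖ - m * ‖δ - δ₀‖) ^ 2 / (2 * m) := by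
        field_simp
        ring
      rw [h3]
      positivity
    linarith [hfo δ]
  have hmin : ∀ δ, D δ = w₀ → V δ₀ ≤ V δ := isMinOn_fibre_of_firstOrder hker hm.le hfo hδ₀
  refine isLittleO_iff.2 fun ε hε => ?_
  have hu := secondOrder_constrValue_upper (q := q) hN hbdd hδ₀ hmin
    (fun ε' hε' => (eventually_abs_le_of_isLittleO_secondOrder hV2 hε').mono fun v hv => hv.1) hε
  have hl := secondOrder_constrValue_lower hN hδ₀ hker hm hfo hq0 hqc
    (fun ε' hε' => (eventually_abs_le_of_isLittleO_secondOrder hV2 hε').mono fun v hv => hv.2) hε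
  filter_upwards [hu, hl] with h hhu hhl
  rw [constrInf_eq_apply_fibreMin (D := (D : E → F)) hN hNmin h] at hhl
  rw [Real.norm_eq_abs, Real.norm_of_nonneg (by positivity), abs_le]
  constructor <;> linarith

/-- A second-order expansion with a form `0 ≤ q ≤ c‖·‖²` carries the first derivative: `HasFDerivAt V V′ δ₀`. [folklore] -/
theorem hasFDerivAt_of_isLittleO_secondOrder {V q : E → ℝ} {V' : E →L[ℝ] ℝ} {δ₀ : E} (hq0 : ∀ v, 0 ≤ q v) {c : ℝ}
    (hqc : ∀ v, q v ≤ c * ‖v‖ ^ 2) (hV2 : (fun v => V (δ₀ + v) - V δ₀ - V' v - q v) =o[𝓝 (0 : E)] fun v => ‖v‖ ^ 2) :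
    HasFDerivAt V V' δ₀ := by
  have hsq : (fun v : E => ‖v‖ ^ 2) =o[𝓝 (0 : E)] fun v => v := by
    refine isLittleO_iff.2 fun ε hε => Metric.eventually_nhds_iff.2 ⟨ε, hε, fun v hv => ?_⟩
    rw [dist_zero_right] at hv
    rw [Real.norm_of_nonneg (by positivity), sq]
    exact mul_le_mul_of_nonneg_right hv.le (norm_nonneg _)
  have hq : (fun v => q v) =O[𝓝 (0 : E)] fun v => ‖v‖ ^ 2 := by
    refine IsBigO.of_bound (max c 0) (Eventually.of_forall fun v => ?_)
    rw [Real.norm_of_nonneg (hq0 v), Real.norm_of_nonneg (by positivity)]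
    exact (hqc v).trans (by gcongr; exact le_max_left _ _)
  have h1 : (fun v => V (δ₀ + v) - V δ₀ - V' v) =o[𝓝 (0 : E)] fun v => v := by
    have h2 := (hV2.add_isBigO hq).trans_isLittleO hsq
    refine h2.congr' (Eventually.of_forall fun v => ?_) EventuallyEq.rfl
    dsimp only
    ring
  exact hasFDerivAt_iff_isLittleO_nhds_zero.2 h1

/-- **THE END, FROM THE MINIMISER LETTER** (no `ker D` hypothesis): `N` a right inverse of `D` and a fibre-minimiser map of `q`,
`δ₀` a minimiser of `V` on the fibre `{D δ = w₀}`, the strong first-order letter at `δ₀` (`m > 0`), `0 ≤ q ≤ c‖·‖²`, the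
second-order expansion of `V` at `δ₀` with quadratic term `q` ⟹
`(h ↦ φ (w₀ + h) − φ w₀ − V′ (N h) − q (N h)) =o[𝓝 0] ‖h‖²` — the step's data ALONE give the value function's second-order
expansion, with quadratic term the constrained Schur form `q_D = q ∘ N` (§1). [folklore] -/
theorem isLittleO_constrValue_secondOrder_of_isMinOn {V q : E → ℝ} {V' : E →L[ℝ] ℝ} {D : E →L[ℝ] F} {N : F →L[ℝ] E}
    (hN : ∀ w, D (N w) = w) (hNmin : ∀ v, q (N (D v)) ≤ q v) {w₀ : F} {δ₀ : E} (hδ₀ : D δ₀ = w₀)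
    (hmin : ∀ δ, D δ = w₀ → V δ₀ ≤ V δ) {m : ℝ} (hm : 0 < m) (hfo : ∀ δ, V δ₀ + V' (δ - δ₀) + m / 2 * ‖δ - δ₀‖ ^ 2 ≤ V δ)
    (hq0 : ∀ v, 0 ≤ q v) {c : ℝ} (hqc : ∀ v, q v ≤ c * ‖v‖ ^ 2)
    (hV2 : (fun v => V (δ₀ + v) - V δ₀ - V' v - q v) =o[𝓝 (0 : E)] fun v => ‖v‖ ^ 2) :
    (fun h => (⨅ δ : {δ // D δ = w₀ + h}, V δ.1) - (⨅ δ : {δ // D δ = w₀}, V δ.1) - V' (N h) - q (N h))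
      =o[𝓝 (0 : F)] fun h => ‖h‖ ^ 2 := by
  have hV : HasFDerivAt V V' δ₀ := hasFDerivAt_of_isLittleO_secondOrder hq0 hqc hV2
  -- Fermat on the fibre (as `…ConstrainedValueDeriv` §1; no olean to import yet): the line `δ₀ + tκ` stays in the fibre
  have hker : ∀ κ, D κ = 0 → V' κ = 0 := by
    intro κ hκ
    have hline : HasDerivAt (fun t : ℝ => δ₀ + t • κ) κ 0 := by
      simpa using ((hasDerivAt_id (0 : ℝ)).smul_const κ).const_add δ₀
    have hV0 : HasFDerivAt V V' (δ₀ + (0 : ℝ) • κ) := by simpa using hV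
    have hloc : IsLocalMin (V ∘ fun t : ℝ => δ₀ + t • κ) 0 :=
      Filter.Eventually.of_forall fun t => by
        simpa using hmin (δ₀ + t • κ) (by rw [map_add, map_smul, hκ, smul_zero, add_zero, hδ₀])
    exact hloc.hasDerivAt_eq_zero (hV0.comp_hasDerivAt (0 : ℝ) hline)
  exact isLittleO_constrValue_secondOrder hN hNmin hδ₀ hker hm hfo hq0 hqc hV2

end Normed

/-! ## §6 Toy check (kernel): the letters are jointly inhabited — `D = N = id`, `φ = V`, the END returns `V`'s own expansion -/

example {E : Type*} [NormedAddCommGroup E] [NormedSpace ℝ E] {V q : E → ℝ} {V' : E →L[ℝ] ℝ} {δ₀ : E}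
    (hmin : ∀ δ, (ContinuousLinearMap.id ℝ E) δ = δ₀ → V δ₀ ≤ V δ) {m : ℝ} (hm : 0 < m)
    (hfo : ∀ δ, V δ₀ + V' (δ - δ₀) + m / 2 * ‖δ - δ₀‖ ^ 2 ≤ V δ) (hq0 : ∀ v, 0 ≤ q v) {c : ℝ} (hqc : ∀ v, q v ≤ c * ‖v‖ ^ 2)
    (hV2 : (fun v => V (δ₀ + v) - V δ₀ - V' v - q v) =o[𝓝 (0 : E)] fun v => ‖v‖ ^ 2) :
    (fun h => (⨅ δ : {δ // (ContinuousLinearMap.id ℝ E) δ = δ₀ + h}, V δ.1)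
        - (⨅ δ : {δ // (ContinuousLinearMap.id ℝ E) δ = δ₀}, V δ.1) - V' ((ContinuousLinearMap.id ℝ E) h)
        - q ((ContinuousLinearMap.id ℝ E) h)) =o[𝓝 (0 : E)] fun h => ‖h‖ ^ 2 :=
  isLittleO_constrValue_secondOrder_of_isMinOn (D := ContinuousLinearMap.id ℝ E) (N := ContinuousLinearMap.id ℝ E)
    (fun _ => rfl) (fun _ => le_rfl) rfl hmin hm hfo hq0 hqc hV2

end Summit.QuantumFields.BalabanUV.T4Continuum.NE7b.ConstrainedValueSecondOrder
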